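import Summits.QuantumFields.BalabanUV.T4Continuum.Support.NE3LocalCrudeWindow
import Summits.QuantumFields.BalabanUV.T4Continuum.Support.MinimalActionLimit
import HarnessLib

/-!
# T⁴ programme, node NE3 — the LOCAL half, reading (D), CRUDE fixed-torus route, part 3:
# THE GLOBAL ENERGY RATE IS GEOMETRIC (d = 4), AND THE PER-LEVEL (D) BOUND `≤ C_D·(L⁻¹)^k` FROM T-E + REGULAR PAIRS

NE3 prover lineage P1, gen 18 (cell `pub-balaban`, unit `b2b-balaban-t4-ne3-p1`, row NE3 OWNER; journal NOTE l.10685).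

CONTENT (0 def, 0 sorry): §1 `residualScale_four_le` — at `d = 4`, P2's residual scale is geometric:
`residualScale 4 L N b g k ≤ wallConst 4 L·N²·(√g·dualC2 + 2b²·dualC1)·(L⁻¹)^k` (`L ≥ 1`, `g ≥ 0`); §2 `crude_core` (pure real
arithmetic: the window and direction terms of part 2 at `#Y ≤ W₀·(L^k)⁴` and `E ≤ R·(L⁻¹)^k` are `≤ K·(L⁻¹)^k` with `K`
displayed); §3 **`abs_loc_succ_sub_le_of_energyRate`** — for `d = 4`, a datum `V ∈ dom`, a level `k ≥ 1`, a run-`k` minimiser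
`U_A` and a run-`(k+1)` minimiser `U_B` with `RegularSup 4 L N b c (k+1) U_B` ((H∃) in choice form) and P2's ROOT
`NE3EnergyShapes.NE3EnergyRate 4 𝒞 L N b (gradConst 4 c) C dom` (T-E, a typed HYPOTHESIS of the row): on every window
`Y ⊆ periodBox (N·L^k)` with `#Y ≤ W₀·(L^k)^4`,
`|A_Y(U_A) − A_{B(Y)}(U_B)| ≤ K·(L⁻¹)^k` with the displayed `K(L, N, b, c, C, W₀, #Pl)` — the (D) reading of a window of
`W₀` unit cubes read through its level-`k` sites `Y`, rate `L⁻¹`, constant `∝ N⁴` through the square of `residualScale` (the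
GLOBAL energy norm of T-E is charged to every window: NO localisation δ, NO (W2) — hence «crude»).
The `LocalRate` packaging over nested windows `Y_{k+1} = B(Y_k)` (and the trivial `k = 0` step) is bookkeeping left to part 4.

HONEST FRAMING.  **NE3 is NOT proved**: T-E (`NE3EnergyRate`, whose leaves ML = B9 Thm 3.3 TYPE, L1∕L2∕L11 are printed-TYPE
hypotheses of roads P2∕P3) and the minimisers' regularity ((H∃)) are hypotheses; nothing printed is a hypothesis of a theorem; no
conditional of the cell (`BetaPertH`, (B), (B^μ), G-an2-4); no `def`, no `sorry`, axioms ⊆ {propext, Classical.choice, Quot.sound}.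
Finite T⁴ rung (B)+1 — NOT infinite volume, NOT a mass gap, NOT the Clay problem, NOT summit progress.  PLACEMENT:
`Summits/QuantumFields/BalabanUV/`.  HONEST DEPENDENCY (cell page 1): continuum YM on T⁴ ⇐ BetaPertH ∧ nine spine estimates (0/9
proved); BetaPertH ⇐ (D1) ∧ (D4) ∧ CAP+tail; G-an2-4 gates asym, D1 and NE2/3/4.
-/

set_option autoImplicit false

open scoped BigOperators Matrix Matrix.Norms.L2Operator
open NormedSpace Finset

namespace Summit.QuantumFields.BalabanUV.T4Continuum.NE3LocalCrudeRate

open Literature.MathematicalPhysics.QuantumFieldTheory.Balaban1983to89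
open B7Prop1Explicit B7Prop2Explicit MatrixLog UnitaryModel
open T4AveragingDeficitWall hiding Site Plane Plaq Bond
open T4AveragingDeficitWallBoundary (periodBox)
open T4AveragingDeficitNonAbelian (wallConstLoc)
open AveragingDeficitPeriodicCounting (IsPeriodicDir)
open AveragingDeficitDualResidual (dualC1 dualC2)
open AveragingDeficitDerivWallProof (wallConst wallConst_nonneg)
open MinimalActionLevels (avgRadius)
open MinimalActionSandwich MinimalActionRate MinimalActionRefine
open NE3EnergyShapes (energyNorm energyNorm_nonneg residualScale NE3EnergyRate dualC1_nonneg dualC2_nonneg)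
open NE3LocalCrudeWindow (abs_windowAction_sub_le_of_regularSup)

noncomputable section

variable {d : ℕ} {n : Type*} [Fintype n] [DecidableEq n] [Nonempty n]

/-! ## §1 The residual scale is geometric at d = 4 -/

omit [Fintype n] [DecidableEq n] [Nonempty n] in
/-- **P2's residual scale at `d = 4` is geometric**: `residualScale 4 L N b g k ≤ wallConst 4 L·N²·(√g·dualC2 + 2b²·dualC1)·(L⁻¹)^k`
(`L ≥ 1`, `g ≥ 0`; P2's docstring: `wallConst·N²·L^{−k}·[√g·dualC2/L + 2b²·dualC1·L^{−k−4}]`). [folklore] -/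
theorem residualScale_four_le {L : ℕ} (hL : 1 ≤ L) (N : ℕ) (b : ℝ) {g : ℝ} (hg : 0 ≤ g) (k : ℕ) :
    residualScale 4 L N b g k
      ≤ wallConst 4 L * (N : ℝ) ^ 2 * (Real.sqrt g * dualC2 4 L + 2 * b ^ 2 * dualC1 4 L) * ((L : ℝ)⁻¹) ^ k := by
  have hL1 : (1 : ℝ) ≤ L := by exact_mod_cast hL
  have hL0 : (0 : ℝ) < L := by linarith
  set s : ℝ := (L : ℝ) ^ k with hsdef
  have hs1 : 1 ≤ s := one_le_pow₀ hL1
  have hs0 : 0 < s := by positivity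
  have hθ : ((L : ℝ)⁻¹) ^ k = 1 / s := by rw [hsdef, inv_pow, one_div]
  have hW := wallConst_nonneg 4 L
  have hC1 := dualC1_nonneg 4 L
  have hC2 := dualC2_nonneg 4 L
  have hN0 : (0 : ℝ) ≤ (N : ℝ) ^ 2 := by positivity
  -- the two square roots
  have hsk : ((L : ℝ) ^ (k + 1)) = L * s := by rw [pow_succ]; ring
  have e1 : g * (N : ℝ) ^ 4 * ((L : ℝ) ^ (k + 1)) ^ 4 / ((L : ℝ) ^ (k + 1)) ^ 6
      = (Real.sqrt g * (N : ℝ) ^ 2 / (L * s)) ^ 2 := by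
    rw [hsk, div_pow, mul_pow (Real.sqrt g) ((N : ℝ) ^ 2) 2, Real.sq_sqrt hg]
    field_simp
  have hr1 : Real.sqrt (g * (N : ℝ) ^ 4 * ((L : ℝ) ^ (k + 1)) ^ 4 / ((L : ℝ) ^ (k + 1)) ^ 6)
      = Real.sqrt g * (N : ℝ) ^ 2 / (L * s) := by
    rw [e1, Real.sqrt_sq (by positivity)]
  have e2 : (4 : ℝ) * (((N * L ^ k : ℕ) : ℝ)) ^ 4 = (2 * ((N : ℝ) * s) ^ 2) ^ 2 := by
    push_cast
    rw [hsdef]; ring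
  have hr2 : Real.sqrt ((4 : ℕ) * (((N * L ^ k : ℕ) : ℝ)) ^ 4) = 2 * ((N : ℝ) * s) ^ 2 := by
    rw [show ((4 : ℕ) : ℝ) = 4 by norm_num, e2, Real.sqrt_sq (by positivity)]
  unfold NE3EnergyShapes.residualScale
  rw [hr1, hr2, hθ, hsk]
  have hpow : (L : ℝ) ^ (4 - ((4 : ℕ) : ℤ)) = 1 := by norm_num
  rw [hpow, one_mul]
  -- compare term by term: `√g N² dualC2/(L s) ≤ √g N² dualC2 / s`, `(b/(L s)²)²·dualC1·2(N s)² ≤ 2 b² dualC1 N²/s`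
  have hsg : 0 ≤ Real.sqrt g := Real.sqrt_nonneg g
  have t1 : Real.sqrt g * (N : ℝ) ^ 2 / (L * s) * dualC2 4 L ≤ Real.sqrt g * dualC2 4 L * (N : ℝ) ^ 2 * (1 / s) := by
    have e3 : Real.sqrt g * (N : ℝ) ^ 2 / (L * s) * dualC2 4 L
        = Real.sqrt g * dualC2 4 L * (N : ℝ) ^ 2 * (1 / ((L : ℝ) * s)) := by ring
    rw [e3]
    have h1 : 1 / ((L : ℝ) * s) ≤ 1 / s := by
      apply one_div_le_one_div_of_le hs0
      nlinarith
    have h0 : 0 ≤ Real.sqrt g * dualC2 4 L * (N : ℝ) ^ 2 := by positivity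
    exact mul_le_mul_of_nonneg_left h1 h0
  have t2 : (b / ((L : ℝ) * s) ^ 2) ^ 2 * dualC1 4 L * (2 * ((N : ℝ) * s) ^ 2)
      ≤ 2 * b ^ 2 * dualC1 4 L * (N : ℝ) ^ 2 * (1 / s) := by
    have e3 : (b / ((L : ℝ) * s) ^ 2) ^ 2 * dualC1 4 L * (2 * ((N : ℝ) * s) ^ 2)
        = 2 * b ^ 2 * dualC1 4 L * (N : ℝ) ^ 2 * (1 / ((L : ℝ) ^ 4 * s ^ 2)) := by
      field_simp
    rw [e3]
    have h1 : 1 / ((L : ℝ) ^ 4 * s ^ 2) ≤ 1 / s := by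
      apply one_div_le_one_div_of_le hs0
      have hL4 : (1 : ℝ) ≤ (L : ℝ) ^ 4 := one_le_pow₀ hL1
      nlinarith
    have h0 : 0 ≤ 2 * b ^ 2 * dualC1 4 L * (N : ℝ) ^ 2 := by positivity
    exact mul_le_mul_of_nonneg_left h1 h0
  have hsum := add_le_add t1 t2
  calc wallConst 4 L * (Real.sqrt g * (N : ℝ) ^ 2 / (L * s) * dualC2 4 L
        + (b / ((L : ℝ) * s) ^ 2) ^ 2 * dualC1 4 L * (2 * ((N : ℝ) * s) ^ 2))
      ≤ wallConst 4 L * (Real.sqrt g * dualC2 4 L * (N : ℝ) ^ 2 * (1 / s)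
        + 2 * b ^ 2 * dualC1 4 L * (N : ℝ) ^ 2 * (1 / s)) := mul_le_mul_of_nonneg_left hsum hW
    _ = wallConst 4 L * (N : ℝ) ^ 2 * (Real.sqrt g * dualC2 4 L + 2 * b ^ 2 * dualC1 4 L) * (1 / s) := by ring

/-! ## §2 The pure-real core of the per-level window bound -/

omit [Fintype n] [DecidableEq n] [Nonempty n] in
/-- **Pure-real core of §3** (opaque atoms).  With `s = L^k ≥ 1`, `L ≥ 1`, `0 ≤ Q ≤ 5L`, a window of `Y ≤ W₀·s⁴` sites,
radii `a_B = b/(Ls)²`, `γ = c/(Ls)³`, averaged radius `av = L²a_B + 226(320L²a_B)²` and an energy `0 ≤ E ≤ R/s`, the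
right-hand side of part 2's `abs_windowAction_sub_le_of_regularSup` at `d = 4` is `≤ K·(1/s)`,
`K = wl·W₀·(2500L³P(bc + c²) + b³) + (b + 23142400b²)·√(W₀P)·R + 14P·R²`. [folklore] -/
theorem crude_core {wl L Q s W₀ P b c Y aB γ av E R : ℝ} (hwl : 0 ≤ wl) (hL : 1 ≤ L) (hQ0 : 0 ≤ Q) (hQ : Q ≤ 5 * L)
    (hs : 1 ≤ s) (hW₀ : 0 ≤ W₀) (hP : 0 ≤ P) (hb : 0 ≤ b) (hc : 0 ≤ c) (hY0 : 0 ≤ Y) (hY : Y ≤ W₀ * s ^ 4)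
    (haB : aB = b / (L * s) ^ 2) (hγ : γ = c / (L * s) ^ 3) (hav : av = L ^ 2 * aB + 226 * (320 * L ^ 2 * aB) ^ 2)
    (hE0 : 0 ≤ E) (hR : 0 ≤ R) (hE : E ≤ R / s) :
    wl * (Y * (L ^ 4 * Q ^ 4 * (4 * (P * (aB * γ + γ ^ 2))) + aB ^ 3))
        + (av * (Real.sqrt (Y * P) * E) + 14 * P * E ^ 2)
      ≤ (wl * W₀ * (2500 * L ^ 3 * P * (b * c + c ^ 2) + b ^ 3)
          + ((b + 23142400 * b ^ 2) * Real.sqrt (W₀ * P) * R + 14 * P * R ^ 2)) * (1 / s) := by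
  have hL0 : 0 < L := by linarith
  have hs0 : 0 < s := by linarith
  have haB0 : 0 ≤ aB := by rw [haB]; positivity
  have hγ0 : 0 ≤ γ := by rw [hγ]; positivity
  -- reciprocal comparisons
  have i2 : 1 / (L ^ 6 * s ^ 2) ≤ 1 / s := by
    apply one_div_le_one_div_of_le hs0
    have h6 : (1 : ℝ) ≤ L ^ 6 := one_le_pow₀ hL
    have : s ≤ s ^ 2 := by nlinarith
    nlinarith
  have i3 : 1 / s ^ 2 ≤ 1 / s := by
    apply one_div_le_one_div_of_le hs0; nlinarith
  -- `L⁴ Q⁴ ≤ 625 L⁸`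
  have hQ4 : L ^ 4 * Q ^ 4 ≤ 625 * L ^ 8 := by
    have h := pow_le_pow_left₀ hQ0 hQ 4
    have e : (5 * L) ^ 4 = 625 * L ^ 4 := by ring
    rw [e] at h
    have hL4 : (0 : ℝ) ≤ L ^ 4 := by positivity
    have := mul_le_mul_of_nonneg_left h hL4
    nlinarith
  -- (i) the mixed window term `L⁴Q⁴·Y·a_Bγ ≤ 625 L³ W₀ bc /s`
  have t1 : L ^ 4 * Q ^ 4 * (Y * (aB * γ)) ≤ 625 * L ^ 3 * W₀ * (b * c) * (1 / s) := by
    have e : s ^ 4 * (aB * γ) = b * c * (1 / (L ^ 5 * s)) := by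
      rw [haB, hγ]; field_simp
    have h1 : Y * (aB * γ) ≤ W₀ * (b * c) * (1 / (L ^ 5 * s)) := by
      calc Y * (aB * γ) ≤ W₀ * s ^ 4 * (aB * γ) := mul_le_mul_of_nonneg_right hY (mul_nonneg haB0 hγ0)
        _ = W₀ * (s ^ 4 * (aB * γ)) := by ring
        _ = W₀ * (b * c) * (1 / (L ^ 5 * s)) := by rw [e]; ring
    have h2 := mul_le_mul hQ4 h1 (by positivity) (by positivity)
    have e2 : 625 * L ^ 8 * (W₀ * (b * c) * (1 / (L ^ 5 * s))) = 625 * L ^ 3 * W₀ * (b * c) * (1 / s) := by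
      field_simp
    exact h2.trans (le_of_eq e2)
  -- (ii) the pure gradient window term `L⁴Q⁴·Y·γ² ≤ 625 L³ W₀ c² /s`
  have t2 : L ^ 4 * Q ^ 4 * (Y * γ ^ 2) ≤ 625 * L ^ 3 * W₀ * c ^ 2 * (1 / s) := by
    have e : s ^ 4 * γ ^ 2 = c ^ 2 * (1 / (L ^ 6 * s ^ 2)) := by
      rw [hγ]; field_simp
    have h1 : Y * γ ^ 2 ≤ W₀ * c ^ 2 * (1 / (L ^ 6 * s ^ 2)) := by
      calc Y * γ ^ 2 ≤ W₀ * s ^ 4 * γ ^ 2 := mul_le_mul_of_nonneg_right hY (sq_nonneg γ)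
        _ = W₀ * (s ^ 4 * γ ^ 2) := by ring
        _ = W₀ * c ^ 2 * (1 / (L ^ 6 * s ^ 2)) := by rw [e]; ring
    have h2 := mul_le_mul hQ4 h1 (by positivity) (by positivity)
    have e2 : 625 * L ^ 8 * (W₀ * c ^ 2 * (1 / (L ^ 6 * s ^ 2))) = 625 * L ^ 2 * W₀ * c ^ 2 * (1 / s ^ 2) := by
      field_simp
    have hL3 : L ^ 2 ≤ L ^ 3 := pow_le_pow_right₀ hL (by norm_num)
    have h3 : 625 * L ^ 2 * W₀ * c ^ 2 ≤ 625 * L ^ 3 * W₀ * c ^ 2 := by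
      have := mul_le_mul_of_nonneg_right hL3 (by positivity : (0 : ℝ) ≤ 625 * W₀ * c ^ 2)
      nlinarith
    have h4 := mul_le_mul h3 i3 (by positivity) (by positivity)
    exact (h2.trans (le_of_eq e2)).trans h4
  -- (iii) the cubic budget `Y·a_B³ ≤ W₀ b³ /s`
  have t3 : Y * aB ^ 3 ≤ W₀ * b ^ 3 * (1 / s) := by
    have e : s ^ 4 * aB ^ 3 = b ^ 3 * (1 / (L ^ 6 * s ^ 2)) := by
      rw [haB]; field_simp
    calc Y * aB ^ 3 ≤ W₀ * s ^ 4 * aB ^ 3 := mul_le_mul_of_nonneg_right hY (pow_nonneg haB0 3)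
      _ = W₀ * (s ^ 4 * aB ^ 3) := by ring
      _ = W₀ * (b ^ 3 * (1 / (L ^ 6 * s ^ 2))) := by rw [e]
      _ ≤ W₀ * (b ^ 3 * (1 / s)) := mul_le_mul_of_nonneg_left (mul_le_mul_of_nonneg_left i2 (pow_nonneg hb 3)) hW₀
      _ = W₀ * b ^ 3 * (1 / s) := by ring
  -- (iv) the direction term `av·√(YP)·E ≤ (b + 23142400 b²)·√(W₀P)·R /s`
  have hsq : Real.sqrt (Y * P) ≤ s ^ 2 * Real.sqrt (W₀ * P) := by
    have h1 : Y * P ≤ (s ^ 2) ^ 2 * (W₀ * P) := by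
      have := mul_le_mul_of_nonneg_right hY hP; nlinarith
    calc Real.sqrt (Y * P) ≤ Real.sqrt ((s ^ 2) ^ 2 * (W₀ * P)) := Real.sqrt_le_sqrt h1
      _ = s ^ 2 * Real.sqrt (W₀ * P) := by rw [Real.sqrt_mul (by positivity), Real.sqrt_sq (by positivity)]
  have hav0 : 0 ≤ av := by rw [hav]; positivity
  have t4 : av * (Real.sqrt (Y * P) * E) ≤ (b + 23142400 * b ^ 2) * Real.sqrt (W₀ * P) * R * (1 / s) := by
    have h1 : Real.sqrt (Y * P) * E ≤ s ^ 2 * Real.sqrt (W₀ * P) * (R / s) :=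
      mul_le_mul hsq hE hE0 (by positivity)
    have h2 := mul_le_mul_of_nonneg_left h1 hav0
    have hs2 : (0 : ℝ) < s ^ 2 := by positivity
    have k1 : b / s ^ 2 * s ^ 2 = b := div_mul_cancel₀ b hs2.ne'
    have hu' : L ^ 2 * aB = b / s ^ 2 := by rw [haB]; field_simp
    have eav : av = b / s ^ 2 + 23142400 * (b / s ^ 2) ^ 2 := by
      rw [hav, show (320 : ℝ) * L ^ 2 * aB = 320 * (L ^ 2 * aB) from by ring, hu']; ring
    have e : av * (s ^ 2 * Real.sqrt (W₀ * P) * (R / s))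
        = (b + 23142400 * b * (b / s ^ 2)) * Real.sqrt (W₀ * P) * R * (1 / s) := by
      rw [eav, div_eq_mul_one_div R s]
      linear_combination (Real.sqrt (W₀ * P) * R * (1 / s)) * (1 + 23142400 * (b / s ^ 2)) * k1
    have hu : b / s ^ 2 ≤ b := div_le_self hb (one_le_pow₀ hs)
    have h3 : b + 23142400 * b * (b / s ^ 2) ≤ b + 23142400 * b ^ 2 := by
      have := mul_le_mul_of_nonneg_left hu (by positivity : (0 : ℝ) ≤ 23142400 * b)
      calc b + 23142400 * b * (b / s ^ 2) ≤ b + 23142400 * b * b := by linarith only [this]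
        _ = b + 23142400 * b ^ 2 := by ring
    have h4 : (b + 23142400 * b * (b / s ^ 2)) * Real.sqrt (W₀ * P) * R * (1 / s)
        ≤ (b + 23142400 * b ^ 2) * Real.sqrt (W₀ * P) * R * (1 / s) := by
      have h0 : 0 ≤ Real.sqrt (W₀ * P) * R * (1 / s) := by positivity
      have := mul_le_mul_of_nonneg_right h3 h0
      calc (b + 23142400 * b * (b / s ^ 2)) * Real.sqrt (W₀ * P) * R * (1 / s)
          = (b + 23142400 * b * (b / s ^ 2)) * (Real.sqrt (W₀ * P) * R * (1 / s)) := by ring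
        _ ≤ (b + 23142400 * b ^ 2) * (Real.sqrt (W₀ * P) * R * (1 / s)) := this
        _ = (b + 23142400 * b ^ 2) * Real.sqrt (W₀ * P) * R * (1 / s) := by ring
    exact (h2.trans (le_of_eq e)).trans h4
  -- (v) the quadratic direction term `14 P E² ≤ 14 P R² /s`
  have t5 : 14 * P * E ^ 2 ≤ 14 * P * R ^ 2 * (1 / s) := by
    have h1 : E ^ 2 ≤ (R / s) ^ 2 := pow_le_pow_left₀ hE0 hE 2
    have e : (R / s) ^ 2 = R ^ 2 * (1 / s ^ 2) := by field_simp
    have h2 : R ^ 2 * (1 / s ^ 2) ≤ R ^ 2 * (1 / s) := mul_le_mul_of_nonneg_left i3 (sq_nonneg R)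
    have h3 := mul_le_mul_of_nonneg_left ((h1.trans (le_of_eq e)).trans h2) (by positivity : (0 : ℝ) ≤ 14 * P)
    calc 14 * P * E ^ 2 = 14 * P * (E ^ 2) := by ring
      _ ≤ 14 * P * (R ^ 2 * (1 / s)) := h3
      _ = 14 * P * R ^ 2 * (1 / s) := by ring
  -- assemble
  have hP4 : (0 : ℝ) ≤ 4 * P := by positivity
  have s12 := mul_le_mul_of_nonneg_left (add_le_add t1 t2) hP4
  have hwin : Y * (L ^ 4 * Q ^ 4 * (4 * (P * (aB * γ + γ ^ 2))) + aB ^ 3)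
      ≤ W₀ * (2500 * L ^ 3 * P * (b * c + c ^ 2) + b ^ 3) * (1 / s) := by
    have e1 : Y * (L ^ 4 * Q ^ 4 * (4 * (P * (aB * γ + γ ^ 2))) + aB ^ 3)
        = 4 * P * (L ^ 4 * Q ^ 4 * (Y * (aB * γ)) + L ^ 4 * Q ^ 4 * (Y * γ ^ 2)) + Y * aB ^ 3 := by ring
    have e2 : W₀ * (2500 * L ^ 3 * P * (b * c + c ^ 2) + b ^ 3) * (1 / s)
        = 4 * P * (625 * L ^ 3 * W₀ * (b * c) * (1 / s) + 625 * L ^ 3 * W₀ * c ^ 2 * (1 / s))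
          + W₀ * b ^ 3 * (1 / s) := by ring
    rw [e1, e2]
    exact add_le_add s12 t3
  have hw := mul_le_mul_of_nonneg_left hwin hwl
  have e3 : (wl * W₀ * (2500 * L ^ 3 * P * (b * c + c ^ 2) + b ^ 3)
        + ((b + 23142400 * b ^ 2) * Real.sqrt (W₀ * P) * R + 14 * P * R ^ 2)) * (1 / s)
      = wl * (W₀ * (2500 * L ^ 3 * P * (b * c + c ^ 2) + b ^ 3) * (1 / s))
        + ((b + 23142400 * b ^ 2) * Real.sqrt (W₀ * P) * R * (1 / s) + 14 * P * R ^ 2 * (1 / s)) := by ring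
  rw [e3]
  exact add_le_add hw (add_le_add t4 t5)

/-! ## §3 The per-level (D) bound from T-E and a regular minimiser pair (d = 4) -/

/-- **THE PER-LEVEL LOCAL BOUND, READING (D), FROM P2's ROOT T-E AND A REGULAR MINIMISER PAIR** (`d = 4`, fixed torus of
side `N`, NO localisation).  Let `L, N ≥ 1`, `0 ≤ b, c, C, W₀`, `20480·L²·b ≤ 1`; assume P2's `NE3EnergyRate 4 𝒞 L N b
(gradConst 4 c) C dom` (T-E — a typed HYPOTHESIS, asserted nowhere).  For a datum `V ∈ dom`, a level `k ≥ 1`, a run-`k`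
minimiser `U_A`, a run-`(k+1)` minimiser `U_B` with `RegularSup 4 L N b c (k+1) U_B` ((H∃) in choice form), and a window
`Y ⊆ [0, N·L^k)^4` of at most `W₀·(L^k)^4` level-`k` sites:
`|A_Y(U_A) − A_{B(Y)}(U_B)| ≤ K·(L⁻¹)^k`,
`K = wallConstLoc·W₀·(2500L³·#Pl·(bc + c²) + b³) + (b + 23142400b²)·√(W₀·#Pl)·R + 14·#Pl·R²`,
`R = C·wallConst·N²·(√(gradConst 4 c)·dualC2 + 2b²·dualC1)` — rate `L⁻¹`, constant `∝ N⁴` (crude: the GLOBAL energy norm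
of T-E is charged to every window). [folklore] -/
theorem abs_loc_succ_sub_le_of_energyRate {𝒞 : ℕ → Set (Site 4 → Fin 4 → (Matrix n n ℂ)ˣ)} {L N : ℕ} (hL : 1 ≤ L)
    (hN : 1 ≤ N) {b c C W₀ : ℝ} (hb : 0 ≤ b) (hc : 0 ≤ c) (hC : 0 ≤ C) (hW₀ : 0 ≤ W₀)
    (hbs : 20480 * (L : ℝ) ^ 2 * b ≤ 1) {dom : Set (Site 4 → Fin 4 → (Matrix n n ℂ)ˣ)}
    (hTE : NE3EnergyRate 4 𝒞 L N b (gradConst 4 c) C dom) {V : Site 4 → Fin 4 → (Matrix n n ℂ)ˣ} (hV : V ∈ dom)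
    {k : ℕ} (hk : 1 ≤ k) {UA UB : Site 4 → Fin 4 → (Matrix n n ℂ)ˣ} (hA : IsMinimiser 4 𝒞 L N k V UA)
    (hB : IsMinimiser 4 𝒞 L N (k + 1) V UB) (hreg : RegularSup 4 L N b c (k + 1) UB) {Y : Finset (Site 4)}
    (hY : Y ⊆ periodBox (N * L ^ k)) (hYc : (Y.card : ℝ) ≤ W₀ * ((L : ℝ) ^ k) ^ 4) :
    |fineAction UA (Y ×ˢ Finset.univ) - fineAction UB (blockSites L Y ×ˢ Finset.univ)|
      ≤ (wallConstLoc 4 L * W₀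
            * (2500 * (L : ℝ) ^ 3 * Fintype.card (T4AveragingDeficitWall.Plane 4) * (b * c + c ^ 2) + b ^ 3)
          + ((b + 23142400 * b ^ 2) * Real.sqrt (W₀ * Fintype.card (T4AveragingDeficitWall.Plane 4))
              * (C * (wallConst 4 L * (N : ℝ) ^ 2 * (Real.sqrt (gradConst 4 c) * dualC2 4 L + 2 * b ^ 2 * dualC1 4 L)))
            + 14 * Fintype.card (T4AveragingDeficitWall.Plane 4)
              * (C * (wallConst 4 L * (N : ℝ) ^ 2 * (Real.sqrt (gradConst 4 c) * dualC2 4 L + 2 * b ^ 2 * dualC1 4 L))) ^ 2))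
        * ((L : ℝ)⁻¹) ^ k := by
  have hL1 : (1 : ℝ) ≤ L := by exact_mod_cast hL
  set s : ℝ := (L : ℝ) ^ k with hsdef
  have hs1 : 1 ≤ s := one_le_pow₀ hL1
  have hs0 : 0 < s := by positivity
  have hθ : ((L : ℝ)⁻¹) ^ k = 1 / s := by rw [hsdef, inv_pow, one_div]
  have hsk : ((L : ℝ) ^ (k + 1)) = L * s := by rw [pow_succ]; ring
  -- T-E's pair datum `(u, Z)` for the two minimisers
  obtain ⟨u, Z, -, -, hZ, hZp, hrep, hE⟩ := hTE k hk V hV UA UB hA hB hreg.regular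
  have hM : 1 ≤ N * L ^ k := one_le_mul_of_one_le_of_one_le hN (Nat.one_le_pow k L hL)
  -- part 2's two-level read-out on the window
  have hbs' : 512 * ((4 : ℕ) + 1 : ℝ) * ((4 : ℕ) + 4 : ℝ) * (L : ℝ) ^ 2 * b ≤ 1 := by push_cast; linarith
  have hmain := abs_windowAction_sub_le_of_regularSup L hL hb hc hbs' hreg hZ hM hZp hrep hY
  simp only [Nat.cast_ofNat, sub_self, zpow_zero, one_mul, hsk] at hmain
  -- the energy norm is geometric
  set E := energyNorm (rescale L (bavg L UB)) Z (periodBox (N * L ^ k)) with hEdef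
  set R₁ := wallConst 4 L * (N : ℝ) ^ 2 * (Real.sqrt (gradConst 4 c) * dualC2 4 L + 2 * b ^ 2 * dualC1 4 L) with hR₁def
  have hR₁ : 0 ≤ R₁ := by
    have := wallConst_nonneg 4 L
    have := dualC1_nonneg 4 L
    have := dualC2_nonneg 4 L
    positivity
  have hE' : E ≤ C * R₁ / s := by
    have h1 := residualScale_four_le hL N b (gradConst_nonneg (d := 4) c) k
    rw [hθ] at h1
    calc E ≤ C * residualScale 4 L N b (gradConst 4 c) k := hE
      _ ≤ C * (R₁ * (1 / s)) := mul_le_mul_of_nonneg_left h1 hC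
      _ = C * R₁ / s := by ring
  -- the pure-real core
  have hQ : (((2 * (2 * L) + 1 : ℕ)) : ℝ) ≤ 5 * L := by push_cast; linarith
  have hav : avgRadius 4 L (b / ((L : ℝ) * s) ^ 2)
      = (L : ℝ) ^ 2 * (b / ((L : ℝ) * s) ^ 2) + 226 * (320 * (L : ℝ) ^ 2 * (b / ((L : ℝ) * s) ^ 2)) ^ 2 := by
    unfold MinimalActionLevels.avgRadius; push_cast; ring
  have hwl : 0 ≤ wallConstLoc 4 L := by
    unfold T4AveragingDeficitNonAbelian.wallConstLoc
    have := T4AveragingDeficitNonAbelian.wallConstNA_nonneg (d := 4) L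
    positivity
  have hcore := crude_core (Y := (Y.card : ℝ)) (P := (Fintype.card (T4AveragingDeficitWall.Plane 4) : ℝ))
    hwl hL1 (by positivity) hQ hs1 hW₀ (by positivity) hb hc (by positivity) hYc rfl rfl hav
    (energyNorm_nonneg _ _ _) (by positivity : 0 ≤ C * R₁) hE'
  rw [hθ]
  exact hmain.trans hcore

end

end Summit.QuantumFields.BalabanUV.T4Continuum.NE3LocalCrudeRate
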